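import Summits.ResolutionOfSingularities.ResolutionOfSingularities.Theorems.WeightedInvariantLocalWeightedDropTrackCFrames
import Literature.AlgebraicGeometry.Resolution.EmbeddedResolutionExcellentSurfacesSequence
import Literature.AlgebraicGeometry.Resolution.StrictNormalCrossingsAt
import Literature.AlgebraicGeometry.Resolution.RsopMonomialIdeals
import Literature.AlgebraicGeometry.Resolution.RegularLocalRingsUFD
import Literature.AlgebraicGeometry.Resolution.StalkIdealLemmas
import Literature.AlgebraicGeometry.Resolution.MarkedIdealsLemmas
import Literature.AlgebraicGeometry.Resolution.IdealSheafLemmas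
import Literature.AlgebraicGeometry.Resolution.AlterationsEnlargingZ

/-!
# Track C: the END of the Cossart–Jannsen–Saito sequence — total transforms are unit-monomials

[OURS · L1 W4.3 · chain w43, stub worker 4] Lemma L3 (`wonAt_end`) of the Track C skeleton
(`L/res-L1-w43-stub-4/TrackC_Skeleton.lean`) for the engine crux `LocalWeightedDrop`
(stmt-ResolutionOfSingularities-8899). NOT a statement of any manuscript.

At the end `π : Z₁ ⟶ Z₀` of the CJS sequence of `V(f) ⊆ Z₀ = Spec k⟦x₀,x₁,x₂⟧` we know `π⁻¹(V f) = X₁ ∪ B₁` with `X₁`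
closed and TRANSVERSAL to the strict normal crossings divisor `B₁` (`IsTransversalWith`,
`IsStrictNormalCrossingsDivisor`: pointwise regular systems of parameters). At a framed point `z`:
* `radical_span_totalGerm` — `√(t) = I(X₁)_z ∩ I(B₁)_z` for the total transform `t = π♯f` at `z`
  (`stalkIdeal_vanishingIdeal_preimage`, `vanishingIdeal_sup`, `stalkIdeal_inf`);
* `exists_eq_unit_mul_prod_pow_of_prime_dvd` — in a regular local ring (a UFD, Matsumura 20.3 = tree
  `Matsumura1987_20_3_holds`) an element all of whose prime factors are members of a regular system of parameters
  `y` is `u · ∏ yᵢ^{aᵢ}`;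
* `won_of_prime_dvd_rsop` — hence, by an ADAPTED frame (`Frame.exists_adapted`) and the change-of-frame lemma
  (`Frame.won_of_dvd_of_eq_unit_mul_monomial`), every divisor of the total transform in any frame is won;
* `wonAt_end` — `WonAt f π`, by the case analysis `z ∈ X₁` / `z ∈ B₁ ∖ X₁` / `z ∉ π⁻¹(V f)` (there `t` is a unit).
-/

noncomputable section

open CategoryTheory AlgebraicGeometry TopologicalSpace IsLocalRing
open Literature.AlgebraicGeometry.Resolution
open Scheme.IdealSheafData

set_option linter.dupNamespace false -- mandated namespace of this single-conjunct summit

namespace Summit.ResolutionOfSingularities.ResolutionOfSingularities.Theorems.TrackC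

variable {k : Type} [Field k]

/-! ## Unit-monomials in a regular local ring -/

section LocalAlgebra

variable {R : Type} [CommRing R] [IsLocalRing R]

omit [IsLocalRing R] in
/-- Putting one factor back into a monomial (general commutative version). [OURS · folklore] -/
theorem mul_prod_pow_eq_prod_pow_update {n : ℕ} (y : Fin n → R) (a : Fin n → ℕ) (i : Fin n) :
    y i * ∏ j, y j ^ a j = ∏ j, y j ^ Function.update a i (a i + 1) j := by
  rw [← Finset.mul_prod_erase Finset.univ (fun j => y j ^ a j) (Finset.mem_univ i),
    ← Finset.mul_prod_erase Finset.univ (fun j => y j ^ Function.update a i (a i + 1) j) (Finset.mem_univ i)]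
  simp only [Function.update_self]
  have hrest : ∏ j ∈ Finset.univ.erase i, y j ^ Function.update a i (a i + 1) j =
      ∏ j ∈ Finset.univ.erase i, y j ^ a j :=
    Finset.prod_congr rfl fun j hj => by rw [Function.update_of_ne (Finset.ne_of_mem_erase hj)]
  rw [hrest, ← mul_assoc, pow_succ']

/-- **In a regular local ring, an element all of whose prime factors are members of a regular system of
parameters `y` is a unit times a monomial in `y`** (regular local rings are UFDs, Matsumura Thm. 20.3).
[OURS · folklore] -/
theorem exists_eq_unit_mul_prod_pow_of_prime_dvd {n : ℕ} {y : Fin n → R} (hy : IsRsopPart y) {t : R}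
    (ht : t ≠ 0) (h : ∀ q : R, Prime q → q ∣ t → ∃ i, Associated q (y i)) :
    ∃ (u : R) (a : Fin n → ℕ), IsUnit u ∧ t = u * ∏ i, y i ^ a i := by
  haveI := hy.isRegularLocalRing
  haveI := isDomain_of_isRegularLocalRing R
  haveI : UniqueFactorizationMonoid R := Matsumura1987_20_3_holds R hy.isRegularLocalRing
  suffices H : ∀ s : R, s ≠ 0 → (∀ q : R, Prime q → q ∣ s → ∃ i, Associated q (y i)) →
      ∃ (u : R) (a : Fin n → ℕ), IsUnit u ∧ s = u * ∏ i, y i ^ a i from H t ht h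
  intro s
  refine UniqueFactorizationMonoid.induction_on_prime s (fun h0 => (h0 rfl).elim)
    (fun x hx _ _ => ⟨x, fun _ => 0, hx, by simp⟩) ?_
  intro b q hb hq ih _ hprime
  obtain ⟨u, a, hu, hba⟩ := ih hb fun q' hq' hdvd => hprime q' hq' (hdvd.mul_left q)
  obtain ⟨i, c, hc⟩ := hprime q hq (dvd_mul_right q b)
  -- `q * c = y i`, so `q = y i * c⁻¹`
  refine ⟨u * ↑c⁻¹, Function.update a i (a i + 1), hu.mul (Units.isUnit _), ?_⟩
  rw [← mul_prod_pow_eq_prod_pow_update y a i, ← hc, hba]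
  have : (q * ↑c) * ↑c⁻¹ = q := by rw [mul_assoc, Units.mul_inv, mul_one]
  calc q * (u * ∏ i, y i ^ a i) = (q * ↑c * ↑c⁻¹) * (u * ∏ i, y i ^ a i) := by rw [this]
    _ = u * ↑c⁻¹ * (q * ↑c * ∏ j, y j ^ a j) := by ring

end LocalAlgebra

/-! ## The radical of the total transform -/

section Radical

variable {S T : Type} [CommRing S] [CommRing T]

omit [Field k] in
/-- `√(φ(√J)) = √(φ(J))`. [OURS · folklore] -/
theorem radical_map_radical (φ : S →+* T) (J : Ideal S) :
    ((J.radical).map φ).radical = (J.map φ).radical :=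
  le_antisymm (Ideal.radical_le_radical_iff.mpr (Ideal.map_radical_le (f := φ) (I := J)))
    (Ideal.radical_mono (Ideal.map_mono J.le_radical))

variable {Z : Scheme.{0}} (π : Z ⟶ Spec (.of (MvPowerSeries (Fin 3) k))) (f : MvPowerSeries (Fin 3) k)

/-- `V(f) ⊆ Z₀` is closed. [OURS · folklore] -/
theorem isClosed_zeroLocus :
    IsClosed ((Spec (.of (MvPowerSeries (Fin 3) k))).zeroLocus (U := ⊤)
      {(Scheme.ΓSpecIso (.of (MvPowerSeries (Fin 3) k))).inv.hom f} : Set _) :=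
  Scheme.zeroLocus_isClosed _ _

/-- **The radical of the total transform is the ideal of the preimage of `V(f)`:**
`√(π♯f · 𝒪_{Z,z}) = I(π⁻¹ V(f))_z`. [OURS · folklore] -/
theorem radical_span_totalGerm (z : Z) :
    (Ideal.span {totalGerm π z f}).radical =
      stalkIdeal (vanishingIdeal ⟨π ⁻¹' ((Spec (.of (MvPowerSeries (Fin 3) k))).zeroLocus (U := ⊤)
        {(Scheme.ΓSpecIso (.of (MvPowerSeries (Fin 3) k))).inv.hom f}),
        (isClosed_zeroLocus f).preimage π.continuous⟩) z := by
  have key := stalkIdeal_vanishingIdeal_preimage π ⟨_, isClosed_zeroLocus (k := k) f⟩ z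
  change _ = stalkIdeal (vanishingIdeal (Closeds.preimage ⟨_, isClosed_zeroLocus (k := k) f⟩ π.continuous)) z
  rw [key]
  -- the ideal of `V(f)` at `π z` is `√(f)`
  have hsupp : (ofIdealTop (Ideal.span {(Scheme.ΓSpecIso (.of (MvPowerSeries (Fin 3) k))).inv.hom f})).support =
      (⟨_, isClosed_zeroLocus (k := k) f⟩ : Closeds _) := by
    apply Closeds.ext
    rw [coe_support_ofIdealTop, Scheme.zeroLocus_span]
    rfl
  have h1 : vanishingIdeal (⟨_, isClosed_zeroLocus (k := k) f⟩ : Closeds _) =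
      (ofIdealTop (Ideal.span {(Scheme.ΓSpecIso (.of (MvPowerSeries (Fin 3) k))).inv.hom f})).radical := by
    rw [← hsupp, vanishingIdeal_support]
  rw [h1, stalkIdeal_radical, stalkIdeal_eq_map_germ _ ⟨⊤, isAffineOpen_top _⟩ (Opens.mem_top _),
    ideal_ofIdealTop_top, Ideal.map_span, Set.image_singleton, radical_map_radical, Ideal.map_span,
    Set.image_singleton]
  congr 2
  rw [Set.singleton_eq_singleton_iff]
  -- `π_z^♯ (germ f) = germ (π♯ f)`
  exact (Scheme.Hom.germ_stalkMap_apply π ⊤ z trivial _).symm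

end Radical

/-! ## From prime factors to the game -/

section Core

variable {Z : Scheme.{0}} {σ : Z ⟶ Spec (.of (MvPowerSeries (Fin 3) k))} {z : Z}
  [hN : IsNoetherianRing (Z.presheaf.stalk z)]

/-- **Core of the end game.** At a framed point, if every prime factor of a non-zero element `t` of the local
ring is associated to a member of a regular system of parameters `y`, then every divisor of `t` read in the
frame is won: `t = u · ∏ yᵢ^{aᵢ}` (`exists_eq_unit_mul_prod_pow_of_prime_dvd`) is a unit times a monomial in
the frame ADAPTED to `y` (`Frame.exists_adapted`), and frames differ by coordinate changes of the game
(`Frame.won_of_dvd_of_eq_unit_mul_monomial`). [OURS · folklore] -/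
theorem won_of_prime_dvd_rsop (F : Frame σ z) {d : ℕ} (y : Fin d → Z.presheaf.stalk z)
    (hspan : Ideal.span (Set.range y) = maximalIdeal (Z.presheaf.stalk z))
    (hdim : ringKrullDim (Z.presheaf.stalk z) = d) (t : Z.presheaf.stalk z) (ht : t ≠ 0)
    (hprime : ∀ q : Z.presheaf.stalk z, Prime q → q ∣ t → ∃ i, Associated q (y i))
    (g : MvPowerSeries (Fin 3) k) (hg : g ∣ F.e (algebraMap _ _ t)) : CobordantGame.Won k 3 g := by
  haveI := F.isRegularLocalRing
  have hd : d = 3 := by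
    have h := hdim.symm.trans F.ringKrullDim_eq
    exact_mod_cast h
  subst hd
  have hy : IsRsopPart y :=
    ⟨F.isRegularLocalRing, 0, Fin.elim0, by simpa using hdim, by simpa using hspan⟩
  obtain ⟨u, a, hu, hta⟩ := exists_eq_unit_mul_prod_pow_of_prime_dvd hy ht hprime
  obtain ⟨F', hF'⟩ := F.exists_adapted y hspan
  have hT : F'.e (algebraMap _ _ t) = F'.e (algebraMap _ _ u) * ∏ i, MvPowerSeries.X i ^ a i := by
    rw [hta, map_mul, map_mul, map_prod, map_prod]
    simp only [map_pow, hF']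
  have hu' : MvPowerSeries.constantCoeff (F'.e (algebraMap _ _ u)) ≠ 0 := by
    have h1 : IsUnit (F'.e (algebraMap _ _ u)) := (hu.map _).map _
    rw [MvPowerSeries.isUnit_iff_constantCoeff] at h1
    exact h1.ne_zero
  exact Frame.won_of_dvd_of_eq_unit_mul_monomial F F' _ _ hu' a hT g hg

end Core

/-! ## The end of the sequence -/

section End

variable (f : MvPowerSeries (Fin 3) k) {Z₁ : Scheme.{0}} (π : Z₁ ⟶ Spec (.of (MvPowerSeries (Fin 3) k)))
  (X₁ B₁ : Set Z₁)

/-- **END (lemma L3 of the Track C skeleton).** At the end `π : Z₁ ⟶ Z₀` of the Cossart–Jannsen–Saito sequence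
of `V(f) ⊆ Z₀` — `π⁻¹(V f) = X₁ ∪ B₁`, `X₁` closed and transversal to the strict normal crossings divisor `B₁`,
total transforms non-zero — every singular divisor of the total transform of `f` at every framed point is won:
`WonAt f π`. At `z ∈ X₁` (resp. `z ∈ B₁ ∖ X₁`) the prime factors of `t = π♯ f` are among the transversal
(resp. snc) parameters since `√(t) = I(X₁)_z ∩ I(B₁)_z`; off `π⁻¹(V f)` the total transform is a unit.
[OURS · folklore] -/
theorem wonAt_end (hX₁c : IsClosed X₁) (hB₁ : IsStrictNormalCrossingsDivisor Z₁ B₁)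
    (htot : π ⁻¹' ((Spec (.of (MvPowerSeries (Fin 3) k))).zeroLocus (U := ⊤)
      {(Scheme.ΓSpecIso (.of (MvPowerSeries (Fin 3) k))).inv.hom f} : Set _) = X₁ ∪ B₁)
    (htr : IsTransversalWith Z₁ X₁ B₁) (hT : ∀ z : Z₁, totalGerm π z f ≠ 0) : WonAt f π := by
  intro z hN F g hg _
  haveI := F.isRegularLocalRing
  haveI := isDomain_of_isRegularLocalRing (Z₁.presheaf.stalk z)
  -- `√(t) = I(X₁)_z ∩ I(B₁)_z`
  have hrad := radical_span_totalGerm π f z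
  have hcl : (⟨π ⁻¹' ((Spec (.of (MvPowerSeries (Fin 3) k))).zeroLocus (U := ⊤)
      {(Scheme.ΓSpecIso (.of (MvPowerSeries (Fin 3) k))).inv.hom f}),
      (isClosed_zeroLocus f).preimage π.continuous⟩ : Closeds Z₁) = ⟨X₁, hX₁c⟩ ⊔ ⟨B₁, hB₁.1⟩ :=
    Closeds.ext (by simpa using htot)
  rw [hcl, vanishingIdeal_sup, stalkIdeal_inf] at hrad
  have hclX : (⟨closure X₁, isClosed_closure⟩ : Closeds Z₁) = ⟨X₁, hX₁c⟩ := Closeds.ext hX₁c.closure_eq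
  have hclB : (⟨closure B₁, isClosed_closure⟩ : Closeds Z₁) = ⟨B₁, hB₁.1⟩ := Closeds.ext hB₁.1.closure_eq
  -- prime factors of `t` see `X₁` or `B₁`
  have hq : ∀ q : Z₁.presheaf.stalk z, Prime q → q ∣ totalGerm π z f →
      stalkIdeal (vanishingIdeal ⟨X₁, hX₁c⟩) z ≤ Ideal.span {q} ∨
        stalkIdeal (vanishingIdeal ⟨B₁, hB₁.1⟩) z ≤ Ideal.span {q} := by
    intro q hq hdvd
    have hP : (Ideal.span {q}).IsPrime := (Ideal.span_singleton_prime hq.ne_zero).mpr hq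
    have h1 : (Ideal.span {totalGerm π z f}).radical ≤ Ideal.span {q} :=
      hP.radical_le_iff.mpr (Ideal.span_singleton_le_span_singleton.mpr hdvd)
    rw [hrad] at h1
    exact hP.inf_le.mp h1
  by_cases hzX : z ∈ X₁
  · -- transversal data at `z ∈ X₁`
    obtain ⟨-, r, e, zv, w, J, hdim, hspan, hIX, hIB⟩ := htr z hzX
    rw [hclX] at hIX
    rw [hclB] at hIB
    refine won_of_prime_dvd_rsop F (Fin.append zv w) (by rwa [range_fin_append]) hdim _ (hT z) ?_ g hg
    intro q hq' hdvd
    rcases hq q hq' hdvd with h | h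
    · -- `(zv) ⊆ (q)`: `r ≠ 0` (else `√(t) = 0`), and `q ∣ zv 0`
      rcases Nat.eq_zero_or_pos r with hr | hr
      · exfalso
        subst hr
        have h0 : Ideal.span (Set.range zv) = ⊥ := by
          rw [Set.range_eq_empty zv, Ideal.span_empty]
        rw [hIX, h0, bot_inf_eq] at hrad
        have : totalGerm π z f ∈ (Ideal.span {totalGerm π z f}).radical :=
          Ideal.le_radical (Ideal.mem_span_singleton_self _)
        rw [hrad] at this
        exact hT z ((Submodule.mem_bot _).mp this)
      · rw [hIX, Ideal.span_le] at h
        have hmem : zv ⟨0, hr⟩ ∈ Ideal.span {q} := h ⟨⟨0, hr⟩, rfl⟩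
        refine ⟨Fin.castAdd e ⟨0, hr⟩, ?_⟩
        rw [Fin.append_left]
        have hyz : IsRsopPart (Fin.append zv w) :=
          ⟨F.isRegularLocalRing, 0, Fin.elim0, by simpa using hdim, by simpa [range_fin_append] using hspan⟩
        have hp : Prime (zv ⟨0, hr⟩) := by
          have := hyz.prime (Fin.castAdd e ⟨0, hr⟩)
          rwa [Fin.append_left] at this
        exact hq'.irreducible.associated_of_dvd hp.irreducible (Ideal.mem_span_singleton.mp hmem)
    · -- `(∏_{j ∈ J} w_j) ⊆ (q)`: `q ∣ w_j` for some `j`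
      rw [hIB, Ideal.span_singleton_le_span_singleton] at h
      obtain ⟨j, -, hj⟩ := (hq'.dvd_finsetProd_iff _).mp h
      refine ⟨Fin.natAdd r j, ?_⟩
      rw [Fin.append_right]
      have hyz : IsRsopPart (Fin.append zv w) :=
        ⟨F.isRegularLocalRing, 0, Fin.elim0, by simpa using hdim, by simpa [range_fin_append] using hspan⟩
      have hp : Prime (w j) := by
        have := hyz.prime (Fin.natAdd r j)
        rwa [Fin.append_right] at this
      exact hq'.irreducible.associated_of_dvd hp.irreducible hj
  · -- `I(X₁)_z = ⊤`
    have hIXtop : stalkIdeal (vanishingIdeal ⟨X₁, hX₁c⟩) z = ⊤ := by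
      apply stalkIdeal_eq_top_of_not_mem_support
      rw [← SetLike.mem_coe, coe_support_vanishingIdeal]
      exact hzX
    by_cases hzB : z ∈ B₁
    · -- snc data at `z ∈ B₁ ∖ X₁`
      obtain ⟨-, r, e, x, y, -, hdim, hspan, hI⟩ := (hB₁.isStrictNormalCrossingsAt hzB)
      rw [hclB] at hI
      refine won_of_prime_dvd_rsop F (Fin.append x y) (by rwa [range_fin_append]) hdim _ (hT z) ?_ g hg
      intro q hq' hdvd
      rcases hq q hq' hdvd with h | h
      · exfalso
        rw [hIXtop, top_le_iff, Ideal.span_singleton_eq_top] at h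
        exact hq'.not_unit h
      · rw [hI, Ideal.span_singleton_le_span_singleton] at h
        obtain ⟨i, -, hi⟩ := (hq'.dvd_finsetProd_iff _).mp h
        refine ⟨Fin.castAdd e i, ?_⟩
        rw [Fin.append_left]
        have hyz : IsRsopPart (Fin.append x y) :=
          ⟨F.isRegularLocalRing, 0, Fin.elim0, by simpa using hdim, by simpa [range_fin_append] using hspan⟩
        have hp : Prime (x i) := by
          have := hyz.prime (Fin.castAdd e i)
          rwa [Fin.append_left] at this
        exact hq'.irreducible.associated_of_dvd hp.irreducible hi
    · -- off `π⁻¹(V f)` the total transform is a unit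
      have hIBtop : stalkIdeal (vanishingIdeal ⟨B₁, hB₁.1⟩) z = ⊤ := by
        apply stalkIdeal_eq_top_of_not_mem_support
        rw [← SetLike.mem_coe, coe_support_vanishingIdeal]
        exact hzB
      rw [hIXtop, hIBtop, top_inf_eq, Ideal.radical_eq_top, Ideal.span_singleton_eq_top] at hrad
      have hunit : IsUnit (F.e (algebraMap _ _ (totalGerm π z f))) := (hrad.map _).map _
      obtain ⟨v, hv⟩ := hunit
      refine won_of_dvd_unit_mul_monomial (F.e (algebraMap _ _ (totalGerm π z f))) ?_ (fun _ => 0) g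
        (by simpa using hg)
      rw [← hv]
      exact (MvPowerSeries.isUnit_iff_constantCoeff.mp v.isUnit).ne_zero

end End

end Summit.ResolutionOfSingularities.ResolutionOfSingularities.Theorems.TrackC

end
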